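import Summits.AtomisticToContinuum.HydrodynamicLimit.Theorems.JParityClosureLocalSecondLawEquilibriumColdBallsWeights
import Summits.AtomisticToContinuum.HydrodynamicLimit.Theorems.JParityClosureLocalSecondLawEquilibriumColdBallsGauss

/-!
# Cold balls, part C: the pointwise (a.e.) majorant of the cold-ball statistic at fixed positions

Lead c2's stub `eq_coldBalls` (equilibrium side-composition of line `exact-entropy-ledger-three-passivities`, crux
`JParityClosure.LocalSecondLaw`, stmt-AtomisticToContinuum-13081).  With the positions `xs` frozen (weights
`bᵢ = b_r(xsᵢ, x₀)`, `W = ∑b`, `ρ_r = W/(N+1)`), the cold-ball statistic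
`ρ_r (1 + log²θ_r) · clamp(2 − 4θ_r/Θ, 0, 1)` of the zipped configuration `zipConfig (xs, vs)` is bounded, for every
velocity vector `vs` whose labels `i ≠ j` (both of positive weight) have distinct velocities, by
`ρ_r · (c₀ + 4K² + 16ℓ²) · 𝟙{θ_r < Θ/2}` with `c₀ = 1 + 2log²(Θ/2)`, `K = log⁺(3ΘW²/(2bᵢbⱼ))` (positions only) and
`ℓ = log⁺(1/‖vsᵢ − vsⱼ‖)` (one Gaussian difference only) — the two-particle temperature bound of part B turned into a
logarithmic majorant (`coldBalls_pointwise`).  Also: the cone fields of a zipped configuration, and the two degenerate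
cases (`W = 0`: the statistic vanishes; at most one positive weight: `θ_r = 0` and the statistic is `ρ_r ≤ 3/(πr³(N+1))`).
-/

noncomputable section

namespace Summit.AtomisticToContinuum.HydrodynamicLimit.Theorems.LocalSecondLawEquilibrium

open scoped BigOperators Topology Classical MeasureTheory ENNReal InnerProductSpace
open Filter Set MeasureTheory ProbabilityTheory
open Literature.MathematicalPhysics.KineticTheory
open Literature.Analysis.FluidPDE
open Summit.AtomisticToContinuum.HydrodynamicLimit.Theorems.LocalSecondLawNegative
open Summit.AtomisticToContinuum.HydrodynamicLimit.Theorems.LocalSecondLawLedger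
open Summit.AtomisticToContinuum.HydrodynamicLimit.Theorems.LocalSecondLawLedger.L

variable {N : ℕ}

/-! ## Cone fields of a zipped configuration -/

/-- The coarse density of a zipped configuration depends on the positions only. -/
theorem rhoC_zipConfig (r : ℝ) (xs : Fin (N + 1) → T3) (vs : Fin (N + 1) → V3) (x₀ : T3) :
    rhoC r (zipConfig (xs, vs)) x₀ = ((N + 1 : ℕ) : ℝ)⁻¹ * ∑ i, cone r (xs i) x₀ := by
  rw [rhoC_eq_sum]; simp only [zipConfig_apply]

/-- The weights are bounded by `3/(πr³)`, hence so is `(N+1)⁻¹` times any single weight... and `W ≤ (N+1)·3/(πr³)`. -/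
theorem sum_cone_le {r : ℝ} (hr : 0 < r) (xs : Fin (N + 1) → T3) (x₀ : T3) :
    ∑ i, cone r (xs i) x₀ ≤ ((N + 1 : ℕ) : ℝ) * (3 / (Real.pi * r ^ 3)) := by
  calc ∑ i, cone r (xs i) x₀ ≤ ∑ _i : Fin (N + 1), 3 / (Real.pi * r ^ 3) :=
        Finset.sum_le_sum fun i _ => cone_le_const hr _ _
    _ = ((N + 1 : ℕ) : ℝ) * (3 / (Real.pi * r ^ 3)) := by
        rw [Finset.sum_const, Finset.card_univ, Fintype.card_fin, nsmul_eq_mul]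

/-! ## The logarithmic majorant -/

/-- `log² t ≤ 2 log²(Θ/2) + 2 L²` with `L = log((Θ/2)/t)`, for `0 < t`, `0 < Θ`. -/
theorem log_sq_le_of_pos {t Θ : ℝ} (ht : 0 < t) (hΘ : 0 < Θ) :
    Real.log t ^ 2 ≤ 2 * Real.log (Θ / 2) ^ 2 + 2 * Real.log (Θ / 2 / t) ^ 2 := by
  have h : Real.log t = Real.log (Θ / 2) - Real.log (Θ / 2 / t) := by
    rw [Real.log_div (by positivity) ht.ne']; ring
  rw [h]
  nlinarith [sq_nonneg (Real.log (Θ / 2) + Real.log (Θ / 2 / t))]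

/-- `log(A·s⁻²) ≤ log⁺A + 2 log⁺(s⁻¹)` for `A, s > 0`. -/
theorem log_mul_inv_sq_le {A s : ℝ} (hA : 0 < A) (hs : 0 < s) :
    Real.log (A * (s ^ 2)⁻¹) ≤ max 0 (Real.log A) + 2 * max 0 (Real.log s⁻¹) := by
  rw [Real.log_mul hA.ne' (by positivity), Real.log_inv, Real.log_pow, Real.log_inv]
  have h1 : Real.log A ≤ max 0 (Real.log A) := le_max_right _ _
  have h2 : -Real.log s ≤ max 0 (-Real.log s) := le_max_right _ _
  push_cast
  linarith

/-- **The logarithmic majorant, real-variable form.**  If `0 ≤ θ < Θ/2`, and whenever `θ > 0` one has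
`(Θ/2)/θ ≤ A·g⁻²` with `A, g > 0`, then `1 + log²θ ≤ (1 + 2log²(Θ/2)) + 4(log⁺A)² + 16(log⁺g⁻¹)²`. -/
theorem one_add_log_sq_le {θ Θ A g : ℝ} (hθ : 0 ≤ θ) (hΘ : 0 < Θ) (hA : 0 < A) (hg : 0 < g)
    (hcold : θ < Θ / 2) (hratio : 0 < θ → Θ / 2 / θ ≤ A * (g ^ 2)⁻¹) :
    1 + Real.log θ ^ 2 ≤ (1 + 2 * Real.log (Θ / 2) ^ 2) + 4 * (max 0 (Real.log A)) ^ 2 +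
      16 * (max 0 (Real.log g⁻¹)) ^ 2 := by
  have hK0 : 0 ≤ max 0 (Real.log A) := le_max_left _ _
  have hℓ0 : 0 ≤ max 0 (Real.log g⁻¹) := le_max_left _ _
  rcases hθ.lt_or_eq with hθpos | hθzero
  · have hL0 : 0 ≤ Real.log (Θ / 2 / θ) :=
      Real.log_nonneg (by rw [le_div_iff₀ hθpos, one_mul]; exact hcold.le)
    have hL : Real.log (Θ / 2 / θ) ≤ max 0 (Real.log A) + 2 * max 0 (Real.log g⁻¹) :=
      (Real.log_le_log (by positivity) (hratio hθpos)).trans (log_mul_inv_sq_le hA hg)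
    have hlog := log_sq_le_of_pos hθpos hΘ
    have hLsq : Real.log (Θ / 2 / θ) ^ 2 ≤ (max 0 (Real.log A) + 2 * max 0 (Real.log g⁻¹)) ^ 2 :=
      pow_le_pow_left₀ hL0 hL 2
    nlinarith [sq_nonneg (max 0 (Real.log A) - 2 * max 0 (Real.log g⁻¹))]
  · rw [← hθzero, Real.log_zero]
    nlinarith [sq_nonneg (Real.log (Θ / 2))]

/-- **Pointwise majorant of the cold-ball statistic at frozen positions.**  For weights `bᵢ = b_r(xsᵢ, x₀)`, a pair
`i ≠ j` of labels of positive weight, and a velocity vector with `vsᵢ ≠ vsⱼ`: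
`ρ(1 + log²θ)·clamp(2 − 4θ/Θ,0,1) ≤ ρ·(c₀ + 4K² + 16ℓ²)·𝟙{θ < Θ/2}` (notation of the module docstring). -/
theorem coldBalls_pointwise {r Θ : ℝ} (hr : 0 < r) (hΘ : 0 < Θ) (xs : Fin (N + 1) → T3) (x₀ : T3)
    {i j : Fin (N + 1)} (hij : i ≠ j) (hbi : 0 < cone r (xs i) x₀) (hbj : 0 < cone r (xs j) x₀)
    (vs : Fin (N + 1) → V3) (hv : vs i ≠ vs j) :
    rhoC r (zipConfig (xs, vs)) x₀ * (1 + Real.log (thetaC r (zipConfig (xs, vs)) x₀) ^ 2) *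
        max 0 (min 1 (2 - 4 * thetaC r (zipConfig (xs, vs)) x₀ / Θ)) ≤
      rhoC r (zipConfig (xs, vs)) x₀ * ((1 + 2 * Real.log (Θ / 2) ^ 2) +
        4 * (max 0 (Real.log (3 * Θ * (∑ k, cone r (xs k) x₀) ^ 2 / (2 * (cone r (xs i) x₀ * cone r (xs j) x₀))))) ^ 2 +
        16 * (max 0 (Real.log ‖vs i - vs j‖⁻¹)) ^ 2) *
      (if thetaC r (zipConfig (xs, vs)) x₀ < Θ / 2 then 1 else 0) := by
  have hN : (0 : ℝ) < ((N + 1 : ℕ) : ℝ) := by positivity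
  have hW : 0 < ∑ k, cone r (xs k) x₀ :=
    Finset.sum_pos' (fun k _ => cone_nonneg hr _ _) ⟨i, Finset.mem_univ _, hbi⟩
  have hρ : rhoC r (zipConfig (xs, vs)) x₀ = ((N + 1 : ℕ) : ℝ)⁻¹ * ∑ k, cone r (xs k) x₀ := rhoC_zipConfig r xs vs x₀
  have hρpos : 0 < rhoC r (zipConfig (xs, vs)) x₀ := by rw [hρ]; exact mul_pos (inv_pos.2 hN) hW
  have hbb : 0 < cone r (xs i) x₀ * cone r (xs j) x₀ := mul_pos hbi hbj
  have hg : 0 < ‖vs i - vs j‖ := norm_pos_iff.2 (sub_ne_zero.2 hv)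
  have hθ0 : 0 ≤ thetaC r (zipConfig (xs, vs)) x₀ := thetaC_nonneg' hr _ x₀
  have hcut1 : max 0 (min 1 (2 - 4 * thetaC r (zipConfig (xs, vs)) x₀ / Θ)) ≤ 1 :=
    max_le zero_le_one (min_le_left _ _)
  -- the two-particle bound of part B: `(N+1)⁻² bᵢbⱼ‖g‖² ≤ 3 θ ρ²`
  have hpair := coldBalls_pairBound hr (zipConfig (xs, vs)) x₀ hρpos.ne' hij
  rw [zipConfig_apply, zipConfig_apply, hρ] at hpair
  -- freeze the atoms (opaque variables: no unfolding of `cone`, `thetaC`, `rhoC` below)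
  generalize hWdef : (∑ k, cone r (xs k) x₀) = W at hW hpair ⊢
  generalize hPdef : cone r (xs i) x₀ * cone r (xs j) x₀ = P at hbb hpair ⊢
  generalize hGdef : ‖vs i - vs j‖ = G at hg hpair ⊢
  generalize hθdef : thetaC r (zipConfig (xs, vs)) x₀ = θ at hθ0 hcut1 hpair ⊢
  generalize hρdef : rhoC r (zipConfig (xs, vs)) x₀ = ρ at hρpos ⊢
  by_cases hcold : θ < Θ / 2
  · rw [if_pos hcold, mul_one]
    have hbθ : P * G ^ 2 ≤ 3 * θ * W ^ 2 := by
      have hc2 : 0 < ((N + 1 : ℕ) : ℝ)⁻¹ ^ 2 := pow_pos (inv_pos.2 hN) 2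
      have h' : ((N + 1 : ℕ) : ℝ)⁻¹ ^ 2 * (P * G ^ 2) ≤ ((N + 1 : ℕ) : ℝ)⁻¹ ^ 2 * (3 * θ * W ^ 2) := by
        calc ((N + 1 : ℕ) : ℝ)⁻¹ ^ 2 * (P * G ^ 2)
            ≤ 3 * θ * (((N + 1 : ℕ) : ℝ)⁻¹ * W) ^ 2 := hpair
          _ = ((N + 1 : ℕ) : ℝ)⁻¹ ^ 2 * (3 * θ * W ^ 2) := by ring
      exact le_of_mul_le_mul_left h' hc2
    have hA : 0 < 3 * Θ * W ^ 2 / (2 * P) := by positivity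
    have hratio : 0 < θ → Θ / 2 / θ ≤ 3 * Θ * W ^ 2 / (2 * P) * (G ^ 2)⁻¹ := by
      intro hθpos
      have hden : 0 < 3 * W ^ 2 := by positivity
      have hθ₀ : P * G ^ 2 / (3 * W ^ 2) ≤ θ := by rw [div_le_iff₀ hden]; linarith
      have hθ₀pos : 0 < P * G ^ 2 / (3 * W ^ 2) := by positivity
      refine (div_le_div_of_nonneg_left (by positivity) hθ₀pos hθ₀).trans_eq ?_
      field_simp
    have hmain := one_add_log_sq_le hθ0 hΘ hA hg hcold hratio
    calc ρ * (1 + Real.log θ ^ 2) * max 0 (min 1 (2 - 4 * θ / Θ))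
        ≤ ρ * (1 + Real.log θ ^ 2) * 1 :=
          mul_le_mul_of_nonneg_left hcut1 (mul_nonneg hρpos.le (by positivity))
      _ ≤ _ := by rw [mul_one]; exact mul_le_mul_of_nonneg_left hmain hρpos.le
  · have hcut : max 0 (min 1 (2 - 4 * θ / Θ)) = 0 := by
      refine max_eq_left (min_le_of_right_le ?_)
      have : 2 ≤ 4 * θ / Θ := by
        rw [le_div_iff₀ hΘ]; linarith [not_lt.1 hcold]
      linarith
    rw [if_neg hcold, hcut, mul_zero, mul_zero]

/-! ## Degenerate configurations -/

/-- If all weights vanish, so does the statistic. -/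
theorem coldBalls_pointwise_zero {r Θ : ℝ} (xs : Fin (N + 1) → T3) (x₀ : T3) (vs : Fin (N + 1) → V3)
    (h : ∑ k, cone r (xs k) x₀ = 0) :
    rhoC r (zipConfig (xs, vs)) x₀ * (1 + Real.log (thetaC r (zipConfig (xs, vs)) x₀) ^ 2) *
      max 0 (min 1 (2 - 4 * thetaC r (zipConfig (xs, vs)) x₀ / Θ)) = 0 := by
  rw [rhoC_zipConfig, h, mul_zero, zero_mul, zero_mul]

/-- **At most one positive weight**: the coarse temperature vanishes and the statistic equals `ρ_r ≤ 3/(πr³(N+1))`. -/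
theorem coldBalls_pointwise_single {r : ℝ} (Θ : ℝ) (hr : 0 < r) (xs : Fin (N + 1) → T3) (x₀ : T3)
    (vs : Fin (N + 1) → V3) (h : ∀ i j, i ≠ j → cone r (xs i) x₀ = 0 ∨ cone r (xs j) x₀ = 0) :
    rhoC r (zipConfig (xs, vs)) x₀ * (1 + Real.log (thetaC r (zipConfig (xs, vs)) x₀) ^ 2) *
      max 0 (min 1 (2 - 4 * thetaC r (zipConfig (xs, vs)) x₀ / Θ)) ≤ 3 / (Real.pi * r ^ 3) / ((N + 1 : ℕ) : ℝ) := by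
  have hθ : thetaC r (zipConfig (xs, vs)) x₀ = 0 :=
    thetaC_eq_zero_of_subsingleton_support r _ x₀ (by simpa only [zipConfig_apply] using h)
  rw [hθ, Real.log_zero]
  have hcut : max 0 (min 1 (2 - 4 * (0 : ℝ) / Θ)) = 1 := by norm_num
  rw [hcut]
  simp only [ne_eq, OfNat.ofNat_ne_zero, not_false_eq_true, zero_pow, add_zero, mul_one]
  rw [rhoC_zipConfig]
  have hN : (0 : ℝ) < ((N + 1 : ℕ) : ℝ) := by positivity
  rw [inv_mul_eq_div, div_le_div_iff_of_pos_right hN]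
  -- at most one positive weight: the sum is at most one term
  by_cases hall : ∀ k, cone r (xs k) x₀ = 0
  · rw [Finset.sum_eq_zero fun k _ => hall k]; positivity
  · push Not at hall
    obtain ⟨k, hk⟩ := hall
    have hothers : ∀ l, l ≠ k → cone r (xs l) x₀ = 0 := fun l hl => by
      rcases h l k hl with h0 | h0
      · exact h0
      · exact absurd h0 hk
    rw [Finset.sum_eq_single k (fun l _ hl => hothers l hl) (fun hk' => absurd (Finset.mem_univ k) hk')]
    exact cone_le_const hr _ _

/-! ## The second-largest weight -/

/-- The second-largest of finitely many reals (with `0` on the diagonal): `max_{(i,j)} (if i = j then 0 else min bᵢ bⱼ)`. -/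
def secondW (b : Fin (N + 1) → ℝ) : ℝ :=
  (Finset.univ ×ˢ (Finset.univ : Finset (Fin (N + 1)))).sup'
    (Finset.univ_nonempty.product Finset.univ_nonempty) fun p => if p.1 = p.2 then 0 else min (b p.1) (b p.2)

/-- Every off-diagonal pair is dominated: `min bᵢ bⱼ ≤ secondW b` for `i ≠ j`. -/
theorem min_le_secondW (b : Fin (N + 1) → ℝ) {i j : Fin (N + 1)} (hij : i ≠ j) : min (b i) (b j) ≤ secondW b := by
  have h := Finset.le_sup' (f := fun p : Fin (N + 1) × Fin (N + 1) => if p.1 = p.2 then (0 : ℝ) else min (b p.1) (b p.2))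
    (Finset.mk_mem_product (Finset.mem_univ i) (Finset.mem_univ j))
  simpa [secondW, hij] using h

/-- The second-largest weight is attained: it is `0` or `min bᵢ bⱼ` for some `i ≠ j`. -/
theorem secondW_cases (b : Fin (N + 1) → ℝ) :
    secondW b = 0 ∨ ∃ i j, i ≠ j ∧ secondW b = min (b i) (b j) := by
  obtain ⟨p, -, hp⟩ := Finset.exists_mem_eq_sup' (Finset.univ_nonempty.product Finset.univ_nonempty)
    (fun p : Fin (N + 1) × Fin (N + 1) => if p.1 = p.2 then (0 : ℝ) else min (b p.1) (b p.2))
  rw [secondW, hp]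
  by_cases h : p.1 = p.2
  · left; simp [h]
  · right; exact ⟨p.1, p.2, h, by simp [h]⟩

/-- For non-negative weights with a largest label `i⋆` and a largest label `j⋆ ≠ i⋆` among the rest,
`secondW b = b j⋆`; in particular `0 ≤ secondW b ≤ max b`. -/
theorem secondW_eq_of_argmax {b : Fin (N + 1) → ℝ} (hb0 : ∀ k, 0 ≤ b k) {i j : Fin (N + 1)} (hij : i ≠ j)
    (hi : ∀ k, b k ≤ b i) (hj : ∀ k, k ≠ i → b k ≤ b j) : secondW b = b j := by
  refine le_antisymm (Finset.sup'_le _ _ fun p _ => ?_) ?_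
  · split_ifs with hp
    · exact hb0 j
    · by_cases h1 : p.1 = i
      · exact (min_le_right _ _).trans (hj _ fun h => hp (h1.trans h.symm))
      · exact (min_le_left _ _).trans (hj _ h1)
  · have h := min_le_secondW b hij
    rwa [min_eq_right ((hj j hij.symm).trans (hi j) |> fun _ => hi j)] at h

/-! ## The cold event is Chebyshev-small when the weights are spread -/

/-- The Chebyshev constant `C₁(ū, Θ) = 16 Var[Y]/Θ² + 27Θ/λ₀²` (`Y` the centred kinetic energy of one Maxwellian
velocity, `λ₀ = min(√Θ/2, Θ/(8(‖ū‖+1)))`). -/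
def chebConst (Θ : ℝ) (ū : V3) : ℝ :=
  16 * Var[fun v : V3 => ‖v‖ ^ 2 / 2 - ‖ū‖ ^ 2 / 2 - 3 * Θ / 2; gaussMeasure ū Θ] / Θ ^ 2 +
    27 * Θ / (min (Real.sqrt Θ / 2) (Θ / (8 * (‖ū‖ + 1)))) ^ 2

/-- `C₁ ≥ 0`. -/
theorem chebConst_nonneg {Θ : ℝ} (hΘ : 0 ≤ Θ) (ū : V3) : 0 ≤ chebConst Θ ū := by
  unfold chebConst
  have := ProbabilityTheory.variance_nonneg (fun v : V3 => ‖v‖ ^ 2 / 2 - ‖ū‖ ^ 2 / 2 - 3 * Θ / 2) (gaussMeasure ū Θ)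
  positivity

/-- **The cold event is Chebyshev-small**: `Q{θ_r(zipConfig(xs,vs)) < Θ/2} ≤ C₁ · ∑ᵢ pᵢ²` with `pᵢ = bᵢ/W` (`W > 0`). -/
theorem measure_coldEvent_le {r Θ : ℝ} (hΘ : 0 < Θ) (ū : V3) (xs : Fin (N + 1) → T3) (x₀ : T3)
    (hW : 0 < ∑ k, cone r (xs k) x₀) :
    Measure.pi (fun _ : Fin (N + 1) => gaussMeasure ū Θ) {vs | thetaC r (zipConfig (xs, vs)) x₀ < Θ / 2} ≤
      ENNReal.ofReal (chebConst Θ ū * ∑ i, (cone r (xs i) x₀ / ∑ k, cone r (xs k) x₀) ^ 2) := by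
  set Q : Measure (Fin (N + 1) → V3) := Measure.pi fun _ : Fin (N + 1) => gaussMeasure ū Θ with hQ
  set W : ℝ := ∑ k, cone r (xs k) x₀ with hWdef
  set p : Fin (N + 1) → ℝ := fun i => cone r (xs i) x₀ / W with hpdef
  set Y : V3 → ℝ := fun v => ‖v‖ ^ 2 / 2 - ‖ū‖ ^ 2 / 2 - 3 * Θ / 2 with hYdef
  set lam : ℝ := min (Real.sqrt Θ / 2) (Θ / (8 * (‖ū‖ + 1))) with hlam
  have hlam0 : 0 < lam := lt_min (by positivity) (by positivity)
  have hN : (0 : ℝ) < ((N + 1 : ℕ) : ℝ) := by positivity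
  have hsp : 0 ≤ ∑ i, p i ^ 2 := Finset.sum_nonneg fun i _ => sq_nonneg _
  -- event inclusion (part B)
  have hsub : {vs : Fin (N + 1) → V3 | thetaC r (zipConfig (xs, vs)) x₀ < Θ / 2} ⊆
      {vs | Θ / 4 ≤ |∑ i, p i * Y (vs i)|} ∪ {vs | lam < ‖∑ i, p i • (vs i - ū)‖} := by
    intro vs hvs
    have hρ : 0 < rhoC r (zipConfig (xs, vs)) x₀ := by rw [rhoC_zipConfig]; exact mul_pos (inv_pos.2 hN) hW
    have h := coldEvent_subset r (zipConfig (xs, vs)) x₀ hρ hΘ ū hvs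
    dsimp only at h
    simp only [zipConfig_apply] at h
    exact h
  -- the energy term
  have hY2 : MemLp Y 2 (gaussMeasure ū Θ) := by
    have hY' : Y = fun v : V3 => ‖v‖ ^ 2 / 2 - (‖ū‖ ^ 2 / 2 + 3 * Θ / 2) := by
      funext v; simp only [hYdef]; ring
    rw [hY']
    exact memLp_energy_gaussMeasure (u := ū) Θ (‖ū‖ ^ 2 / 2 + 3 * Θ / 2)
  have hY0 : ∫ v, Y v ∂gaussMeasure ū Θ = 0 := by
    have h := integral_energy_gaussMeasure ū hΘ (ι := Fin 3)
    rw [Fintype.card_fin] at h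
    rw [← h]
    refine integral_congr_ae (Eventually.of_forall fun v => ?_)
    simp only [hYdef]; push_cast; ring
  have hA : Q {vs | Θ / 4 ≤ |∑ i, p i * Y (vs i)|} ≤
      ENNReal.ofReal ((∑ i, p i ^ 2) * Var[Y; gaussMeasure ū Θ] / (Θ / 4) ^ 2) :=
    pi_weighted_sum_tail_le (gaussMeasure ū Θ) hY2 hY0 p (by positivity)
  -- the momentum term, coordinatewise
  have hcoord : ∀ l : Fin 3, Q {vs | lam / 3 < |(∑ i, p i • (vs i - ū)) l|} ≤
      ENNReal.ofReal ((∑ i, p i ^ 2) * Θ / (lam / 3) ^ 2) := by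
    intro l
    have hYl2 : MemLp (fun v : V3 => v l - ū l) 2 (gaussMeasure ū Θ) :=
      (memLp_coord_gaussMeasure ū Θ l 2 (by simp)).sub (memLp_const _)
    have hYl0 : ∫ v, (v l - ū l) ∂gaussMeasure ū Θ = 0 := by
      rw [integral_sub ((memLp_coord_gaussMeasure ū Θ l 1 (by simp)).integrable le_rfl) (integrable_const _),
        integral_coord_gaussMeasure ū hΘ l, integral_const, probReal_univ, one_smul, sub_self]
    have hvar : Var[fun v : V3 => v l - ū l; gaussMeasure ū Θ] = Θ := by
      have : (fun v : V3 => v l - ū l) = fun v => -ū l + v l := by funext v; ring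
      rw [this, variance_const_add, variance_coord_gaussMeasure ū hΘ.le l]
      exact (memLp_coord_gaussMeasure ū Θ l 2 (by simp)).aestronglyMeasurable
    have h := pi_weighted_sum_tail_le (gaussMeasure ū Θ) hYl2 hYl0 p (δ := lam / 3) (by positivity)
    rw [hvar] at h
    refine (measure_mono fun vs hvs => ?_).trans h
    simp only [mem_setOf_eq] at hvs ⊢
    have heq : (∑ i, p i • (vs i - ū)) l = ∑ i, p i * (vs i l - ū l) := by
      simp [Finset.sum_apply, smul_eq_mul]
    rw [heq] at hvs
    exact hvs.le
  have hB : Q {vs | lam < ‖∑ i, p i • (vs i - ū)‖} ≤ 3 * ENNReal.ofReal ((∑ i, p i ^ 2) * Θ / (lam / 3) ^ 2) := by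
    refine (measure_setOf_lt_norm_le Q (fun vs => ∑ i, p i • (vs i - ū)) hlam0.le).trans ?_
    calc ∑ l, Q {vs | lam / 3 < |(∑ i, p i • (vs i - ū)) l|}
        ≤ ∑ _l : Fin 3, ENNReal.ofReal ((∑ i, p i ^ 2) * Θ / (lam / 3) ^ 2) := Finset.sum_le_sum fun l _ => hcoord l
      _ = 3 * ENNReal.ofReal ((∑ i, p i ^ 2) * Θ / (lam / 3) ^ 2) := by
          rw [Finset.sum_const, Finset.card_univ, Fintype.card_fin]; simp [nsmul_eq_mul]
  have hV0 : 0 ≤ Var[Y; gaussMeasure ū Θ] := ProbabilityTheory.variance_nonneg _ _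
  calc Q {vs | thetaC r (zipConfig (xs, vs)) x₀ < Θ / 2}
      ≤ Q ({vs | Θ / 4 ≤ |∑ i, p i * Y (vs i)|} ∪ {vs | lam < ‖∑ i, p i • (vs i - ū)‖}) := measure_mono hsub
    _ ≤ Q {vs | Θ / 4 ≤ |∑ i, p i * Y (vs i)|} + Q {vs | lam < ‖∑ i, p i • (vs i - ū)‖} := measure_union_le _ _
    _ ≤ ENNReal.ofReal ((∑ i, p i ^ 2) * Var[Y; gaussMeasure ū Θ] / (Θ / 4) ^ 2) +
          3 * ENNReal.ofReal ((∑ i, p i ^ 2) * Θ / (lam / 3) ^ 2) := add_le_add hA hB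
    _ = ENNReal.ofReal (chebConst Θ ū * ∑ i, p i ^ 2) := by
        rw [show (3 : ℝ≥0∞) = ENNReal.ofReal 3 by norm_num, ← ENNReal.ofReal_mul (by norm_num),
          ← ENNReal.ofReal_add (by positivity) (by positivity)]
        congr 1
        simp only [chebConst, hYdef, hlam]
        field_simp
        ring

/-- Two distinct labels almost surely carry distinct velocities under the product Maxwellian law (registered
sub-goal `coldBalls_velEqNull` of stub `eq_coldBalls`). -/
theorem coldBalls_velEqNull :
    ∀ {N : ℕ} (ū : V3) {Θ : ℝ}, 0 < Θ → ∀ {i j : Fin (N + 1)}, i ≠ j → Measure.pi (fun _ : Fin (N + 1) => gaussMeasure ū Θ) {vs | vs i = vs j} = 0 := by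
  intro N ū Θ hΘ i j hij
  set Q : Measure (Fin (N + 1) → V3) := Measure.pi fun _ : Fin (N + 1) => gaussMeasure ū Θ
  set D : ℝ := (2 * Real.pi * Θ) ^ (-(3 : ℝ) / 2) * (4 / 3 * Real.pi) with hD
  have hD0 : 0 ≤ D := by positivity
  have hle : ∀ u : ℝ, 0 < u → Q {vs | vs i = vs j} ≤ ENNReal.ofReal (D * u ^ 3) := by
    intro u hu
    refine (measure_mono fun vs hvs => ?_).trans (pi_gaussMeasure_norm_sub_le' ū hΘ hij hu.le)
    simp only [mem_setOf_eq] at hvs ⊢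
    rw [hvs, sub_self, norm_zero]; exact hu.le
  by_contra hne
  have hpos : 0 < (Q {vs | vs i = vs j}).toReal := by
    refine ENNReal.toReal_pos hne (ne_top_of_le_ne_top ENNReal.ofReal_ne_top (hle 1 one_pos))
  -- choose `u` with `D u³ < measure`
  set m : ℝ := (Q {vs | vs i = vs j}).toReal with hm
  set u : ℝ := min 1 (m / (2 * (D + 1))) with hu
  have hu0 : 0 < u := lt_min one_pos (by positivity)
  have hu1 : u ≤ 1 := min_le_left _ _
  have hDu : D * u ^ 3 < m := by
    have h1 : u ^ 3 ≤ u := by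
      calc u ^ 3 = u * (u * u) := by ring
        _ ≤ u * (1 * 1) := by gcongr
        _ = u := by ring
    have h2 : D * u ≤ (D + 1) * u := by nlinarith
    have h3 : (D + 1) * u ≤ (D + 1) * (m / (2 * (D + 1))) := mul_le_mul_of_nonneg_left (min_le_right _ _) (by positivity)
    have h4 : (D + 1) * (m / (2 * (D + 1))) = m / 2 := by field_simp
    nlinarith [mul_le_mul_of_nonneg_left h1 hD0]
  have h := hle u hu0
  have h' : Q {vs | vs i = vs j} < ENNReal.ofReal m := by
    refine h.trans_lt ((ENNReal.ofReal_lt_ofReal_iff (by linarith)).2 hDu)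
  rw [hm, ENNReal.ofReal_toReal (ne_top_of_le_ne_top ENNReal.ofReal_ne_top (hle 1 one_pos))] at h'
  exact lt_irrefl _ h'

end Summit.AtomisticToContinuum.HydrodynamicLimit.Theorems.LocalSecondLawEquilibrium

end
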